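import Literature.AlgebraicGeometry.Motives.AbelianVarietyWeilPairingIdealTorsionAnnihilator
import Literature.AlgebraicGeometry.Motives.AbelianVarietyWeilPairingPerfectOfCoprime
import Literature.AlgebraicGeometry.AbelianSchemes.WeilPairingLevelIsotropyOfIdealTorsionSections
import Literature.AlgebraicGeometry.AbelianSchemes.IsLambdaOfAtOntoOfAmpleWitness
import Literature.AlgebraicGeometry.AbelianSchemes.FibreHomPointsOfFibrePoints
import Literature.AlgebraicGeometry.AbelianSchemes.AbelianSchemeQuotientIsoOfKernelRank
import Literature.AlgebraicGeometry.AbelianSchemes.SymplecticLiftOfIsogenyTower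
import Literature.AlgebraicGeometry.AbelianSchemes.AbelianSchemeOverFibreDim
import HarnessLib

/-!
# `hcard` in SECTIONS currency: `#A[𝔟](S) · #λ_*A[𝔠](S) = n^{2g}` for an abelian scheme over an algebraically closed field
# ([MumfordAV1970] §20 (pp. 184–186), §23 (p. 233); [MumfordFogartyKirwan1994] Ch. 7 §2 Def. 7.1)

Topic `Literature/AlgebraicGeometry/AbelianSchemes`; namespace `Literature.AlgebraicGeometry.AbelianSchemes.AbelianSchemeOver`.  THEOREMS ONLY (no definition, no
named fact, no instance, no notation, no `sorry`).  Cell `hodgecm-mathlib` (D-0151), P6 «MOD» (crux hLiu418 = stmt-HodgeConjecture-24832, `--supports`,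
count-neutral): line L3 (`stub_FROB`), ROOF road (ρ-𝔟), RULING #5 (C) → LA3-p03 (g2): binder **(b1) `hcard : Nat.card K * Nat.card (K₂.map λ_*) = n ^ (2 g)`**
of the ★ «DUAL-Q» engine head `nonempty_dualPair_quotient_idealTorsion_geometric` (LA6-p03 (g0) p849273; 04:52Z handoff «(b1) ⟸ ★ p849307 + PERFECTNESS +
glue sections ↔ points»).  Assembly of ★ rows only: the COUNT on `Ω`-points ★ `AbelianVariety.natCard_mul_natCard_eq_of_idealTorsion` (p849307), PERFECTNESS
★ `weilPairingLevel_eq_one_of_forall_left_of_coprime` (p849239, `gcd(n, #K(Θ)) = 1`), `#A[n](Ω) = n^{2g}` ★ `natCard_torsionPoints_eq_of_isAlgClosed`,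
`dim A_s = g` ★ `dim_fibre_of_isOfRelDim`, and the SECTIONS ↔ POINTS dictionary over `S = Spec Ω` at `s = 𝟙`: `σ ↦ σ(s)` (★ `restrictPt`) is a group
isomorphism `A(S) ≅ A_s(Ω)` (injective ★ `restrict_injective_of_field` through ★ `eq_restrictPt_iff_eq_restrict`; onto ★ `exists_fibrePoints_fibrePointToLeft_eq`,
the unit `𝟙_ (Over S)` being `Over.mk (𝟙 S)`), compatible with `ι(r)` (★ `fibreAction_restrictPt`) and with `λ` (★ `map_fibreHom_restrictPt`); `λ_*` is
injective on the `n`-torsion `K₂` because `ker λ̄_s ⊆ K(Θ)` (★ `IsLambdaOfAt.setOf_map_fibreHom_eq_one_subset_KTheta`) meets `A[n]` trivially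
(`gcd(n, #K(Θ)) = 1`, ★ `pow_natCard_KTheta_eq_one`, Mathlib `pow_gcd_eq_one`).  HC_CM is proved only modulo the printed citations until rung 0 closes;
this file is generic and changes no count.

* §1 `toUnit_mk_id_eq_id`, `restrict_id_eq` (`A.restrict (𝟙 S) σ = σ`), `restrictPt_id_injective'`, `restrictPt_id_surjective`, `restrictPt_id_bijective`;
* §2 `map_monoidHom_injOn_of_coprime` (`λ_*` is injective on `n`-torsion sections when `gcd(n, #K(Θ)) = 1`), `natCard_map_monoidHom_eq_of_coprime`;
* §3 **`natCard_mul_natCard_map_eq_pow_of_idealTorsion`** — THE (b1) ROW in the binder currency of ★ p849273.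

## References
* [MumfordAV1970] D. Mumford, *Abelian Varieties* (1970), §20 (pp. 184–186), §23 (p. 233).
* [MumfordFogartyKirwan1994] D. Mumford, J. Fogarty, F. Kirwan, *Geometric Invariant Theory*, 3rd ed. (1994), Ch. 7 §2 Definition 7.1 (p. 129), Ch. 6 §2 Definition 6.3 (p. 120).
-/

set_option autoImplicit false

universe u

open CategoryTheory CategoryTheory.Limits AlgebraicGeometry MonoidalCategory CartesianMonoidalCategory

noncomputable section

namespace Literature.AlgebraicGeometry.AbelianSchemes

namespace AbelianSchemeOver

open Literature.AlgebraicGeometry.Motives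
open scoped MonObj

/-! ### §1 Sections over `Spec Ω` ARE the `Ω`-points of the fibre at `𝟙` -/

section Sections

variable {Ω : Type u} [Field Ω] (A : AbelianSchemeOver (Spec (.of Ω)))

/-- The unique morphism from `Over.mk (𝟙 S)` to the monoidal unit `𝟙_ (Over S)` is the identity (both are the chosen terminal object). [folklore] -/
private theorem toUnit_mk_id_eq_id : toUnit (Over.mk (𝟙 (Spec (.of Ω)))) = 𝟙 (𝟙_ (Over (Spec (.of Ω)))) :=
  Subsingleton.elim _ _

/-- At `s = 𝟙 S`, restriction to the fibre point is the identity on sections: `A.restrict (𝟙 S) σ = σ`. [cite: MumfordFogartyKirwan1994, Ch. 7 §2 Definition 7.1 (p. 129)] -/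
theorem restrict_id_eq (σ : A.Sections) : A.restrict (𝟙 (Spec (.of Ω))) σ = σ := by
  change toUnit (Over.mk (𝟙 (Spec (.of Ω)))) ≫ σ = σ
  rw [toUnit_mk_id_eq_id]
  exact Category.id_comp σ

/-- **`σ ↦ σ(𝟙)` is injective** over `Spec Ω` (★ `restrict_injective_of_field` through ★ `eq_restrictPt_iff_eq_restrict`).
[cite: MumfordFogartyKirwan1994, Ch. 7 §2 Definition 7.1 (p. 129)] [cite: MumfordAV1970, §7 Thm. 4 (p. 72)] -/
theorem restrictPt_id_injective' : Function.Injective (A.restrictPt (𝟙 (Spec (.of Ω)))) := by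
  intro σ τ h
  have key := (A.eq_restrictPt_iff_eq_restrict (𝟙 (Spec (.of Ω))) (A.fibrePointToLeft_restrictPt (𝟙 (Spec (.of Ω))) σ) τ).mp h
  exact A.restrict_injective_of_field (𝟙 (Spec (.of Ω))) key

/-- **`σ ↦ σ(𝟙)` is surjective** over `Spec Ω`: every `Ω`-point of the fibre at `𝟙` is a section (★ `exists_fibrePoints_fibrePointToLeft_eq`; a fibre point over
`𝟙 S` IS a section since `𝟙_ (Over S) = Over.mk (𝟙 S)`). [cite: GortzWedhorn2020, Section (4.7), (4.7.1) (p. 108)] -/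
theorem restrictPt_id_surjective : Function.Surjective (A.restrictPt (𝟙 (Spec (.of Ω)))) := by
  intro P
  obtain ⟨x, hx⟩ := A.exists_fibrePoints_fibrePointToLeft_eq (𝟙 (Spec (.of Ω))) P
  refine ⟨x, ?_⟩
  exact ((A.eq_restrictPt_iff_eq_restrict (𝟙 (Spec (.of Ω))) hx x).mpr (A.restrict_id_eq x).symm).symm

/-- `σ ↦ σ(𝟙)` is a bijection `A(Spec Ω) ≃ A_𝟙(Ω)`. [cite: GortzWedhorn2020, Section (4.7), (4.7.1) (p. 108)] -/
theorem restrictPt_id_bijective : Function.Bijective (A.restrictPt (𝟙 (Spec (.of Ω)))) :=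
  ⟨A.restrictPt_id_injective', A.restrictPt_id_surjective⟩

end Sections

/-! ### §2 `λ_*` is injective on the `n`-torsion sections when `gcd(n, #K(Θ)) = 1` -/

section Lam

variable {Ω : Type u} [Field Ω] {A : AbelianSchemeOver (Spec (.of Ω))} (D : A.DualPair) (lam : A.X ⟶ D.hat.X) [IsMonHom lam]
  {Θ : CartierDivisor (A.fibre (𝟙 (Spec (.of Ω)))).toAbelianVariety.X.left}

/-- **`σ ≫ λ = 1`, `σⁿ = 1` ⇒ `σ = 1` when `gcd(n, #K(Θ)) = 1`** (`λ̄_𝟙 = Λ(𝒪(Θ))`): `σ(𝟙) ∈ ker λ̄ ⊆ K(Θ)` (★ `IsLambdaOfAt.setOf_map_fibreHom_eq_one_subset_KTheta`),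
so `σ(𝟙)^{#K(Θ)} = 1 = σ(𝟙)^n`, whence `σ(𝟙) = 1` and `σ = 1` (§1). [cite: MumfordAV1970, §8 Thm. 1 (p. 77) and §23 (p. 233)] -/
theorem eq_one_of_comp_lam_eq_one_of_pow_eq_one_of_coprime (hΘ : A.IsLambdaOfAt (𝟙 (Spec (.of Ω))) D lam Θ) {n : ℕ}
    (hcop : Nat.Coprime n (Nat.card ((A.fibre (𝟙 (Spec (.of Ω)))).toAbelianVariety.KTheta Θ)))
    {σ : A.Sections} (hσn : σ ^ n = 1) (hσ : σ ≫ lam = 1) : σ = 1 := by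
  have hpt : AlgPoints.map (fibreHom lam (𝟙 (Spec (.of Ω)))).hom.hom.hom (A.restrictPt (𝟙 (Spec (.of Ω))) σ) = 1 := by
    rw [map_fibreHom_restrictPt (𝟙 (Spec (.of Ω))) lam σ, hσ, restrictPt_one]
    rfl
  have hK : A.restrictPt (𝟙 (Spec (.of Ω))) σ ∈
      ((A.fibre (𝟙 (Spec (.of Ω)))).toAbelianVariety.KTheta Θ : Set ((A.fibre (𝟙 (Spec (.of Ω)))).toAbelianVariety.Points Ω)) :=
    IsLambdaOfAt.setOf_map_fibreHom_eq_one_subset_KTheta A D (𝟙 (Spec (.of Ω))) hΘ hpt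
  have h1 : A.restrictPt (𝟙 (Spec (.of Ω))) σ ^ Nat.card ((A.fibre (𝟙 (Spec (.of Ω)))).toAbelianVariety.KTheta Θ) = 1 :=
    (A.fibre (𝟙 (Spec (.of Ω)))).toAbelianVariety.pow_natCard_KTheta_eq_one hK
  have h2 : A.restrictPt (𝟙 (Spec (.of Ω))) σ ^ n = 1 := by rw [← restrictPt_pow, hσn, restrictPt_one]
  have h3 : A.restrictPt (𝟙 (Spec (.of Ω))) σ ^ Nat.gcd n (Nat.card ((A.fibre (𝟙 (Spec (.of Ω)))).toAbelianVariety.KTheta Θ)) = 1 :=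
    pow_gcd_eq_one.mpr ⟨h2, h1⟩
  rw [hcop, pow_one, ← restrictPt_one (A := A) (s := 𝟙 (Spec (.of Ω)))] at h3
  exact A.restrictPt_id_injective' h3

/-- **`λ_*` is injective on any subgroup of `n`-torsion sections** when `gcd(n, #K(Θ)) = 1`. [cite: MumfordAV1970, §23 (p. 233)] -/
theorem map_monoidHom_injOn_of_coprime (hΘ : A.IsLambdaOfAt (𝟙 (Spec (.of Ω))) D lam Θ) {n : ℕ}
    (hcop : Nat.Coprime n (Nat.card ((A.fibre (𝟙 (Spec (.of Ω)))).toAbelianVariety.KTheta Θ)))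
    (K₂ : Subgroup A.Sections) (hK₂ : ∀ σ : K₂, (σ : A.Sections) ^ n = 1) :
    Set.InjOn (IsMonHom.monoidHom lam (𝟙_ (Over (Spec (.of Ω))))) (K₂ : Set A.Sections) := by
  intro σ hσ τ hτ h
  have hq : (σ * τ⁻¹) ≫ lam = 1 := by
    have h' := congrArg (fun x => x * (IsMonHom.monoidHom lam (𝟙_ (Over (Spec (.of Ω)))) τ)⁻¹) h
    simp only [mul_inv_cancel] at h'
    rw [← map_inv, ← map_mul] at h'
    exact h'
  have hn : (σ * τ⁻¹) ^ n = 1 := hK₂ ⟨σ * τ⁻¹, K₂.mul_mem hσ (K₂.inv_mem hτ)⟩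
  exact mul_inv_eq_one.mp (eq_one_of_comp_lam_eq_one_of_pow_eq_one_of_coprime D lam hΘ hcop hn hq)

/-- `#λ_*K₂ = #K₂` for a subgroup `K₂` of `n`-torsion sections, `gcd(n, #K(Θ)) = 1`. [cite: MumfordAV1970, §23 (p. 233)] -/
theorem natCard_map_monoidHom_eq_of_coprime (hΘ : A.IsLambdaOfAt (𝟙 (Spec (.of Ω))) D lam Θ) {n : ℕ}
    (hcop : Nat.Coprime n (Nat.card ((A.fibre (𝟙 (Spec (.of Ω)))).toAbelianVariety.KTheta Θ)))
    (K₂ : Subgroup A.Sections) (hK₂ : ∀ σ : K₂, (σ : A.Sections) ^ n = 1) :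
    Nat.card (K₂.map (IsMonHom.monoidHom lam (𝟙_ (Over (Spec (.of Ω)))))) = Nat.card K₂ := by
  rw [← SetLike.coe_sort_coe, Subgroup.coe_map, Nat.card_image_of_injOn (map_monoidHom_injOn_of_coprime D lam hΘ hcop K₂ hK₂), SetLike.coe_sort_coe]

end Lam

/-! ### §3 The (b1) row `hcard` -/

section Count

variable {Ω : Type u} [Field Ω] [IsAlgClosed Ω] {A : AbelianSchemeOver (Spec (.of Ω))} [IsCommMonObj A.X]
  {O : Type*} [CommRing O] [IsDedekindDomain O] (act : A.RingAction O)
  (φ : O → (A.fibre (𝟙 (Spec (.of Ω)))).toAbelianVariety.Points Ω → (A.fibre (𝟙 (Spec (.of Ω)))).toAbelianVariety.Points Ω)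
  (hφ : ∀ r x, φ r x = haveI := act.isMonHom r; AlgPoints.map (fibreHom (act.i r) (𝟙 (Spec (.of Ω)))).hom.hom.hom x)
  (D : A.DualPair) (lam : A.X ⟶ D.hat.X) [IsMonHom lam]

include hφ in
/-- **(b1) `hcard` IN SECTIONS CURRENCY.**  `A` an abelian scheme of relative dimension `g` over `Spec Ω`, `Ω` algebraically closed, with an `𝒪`-action `ι` (`𝒪`
Dedekind) whose fibre action `φ` is onto for `r ≠ 0` and `ē^Θ_n`-adjoint along the ring automorphism `c` (Rosati, ★ `weilPairingLevel_map_fibreHom_eq_of_rosati`);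
`λ : A → Â` with `λ̄_𝟙 = Λ(𝒪(Θ))`; `(n : Ω) ≠ 0`, `(n : 𝒪) ≠ 0`, **`gcd(n, #K(Θ)) = 1`**; nonzero ideals `𝔟 · J′ = (n)`.  If `K ≤ A(S)` is EXACTLY the
`𝔟`-torsion sections and `K₂ ≤ A(S)` EXACTLY the `c(J′)`-torsion sections, then `Nat.card K * Nat.card (K₂.map λ_*) = n ^ (2 * g)` — the binder `hcard` of ★
`nonempty_dualPair_quotient_idealTorsion_geometric`. [cite: MumfordAV1970, §20 (pp. 184–186) and §23 (p. 233)] -/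
theorem natCard_mul_natCard_map_eq_pow_of_idealTorsion {g n : ℕ} (hA : A.IsOfRelDim g) (hn0 : (n : Ω) ≠ 0) (hnO : (n : O) ≠ 0)
    (hsurj : ∀ r : O, r ≠ 0 → Function.Surjective (φ r))
    {Θ : CartierDivisor (A.fibre (𝟙 (Spec (.of Ω)))).toAbelianVariety.X.left} (hΘ : A.IsLambdaOfAt (𝟙 (Spec (.of Ω))) D lam Θ)
    (hcop : Nat.Coprime n (Nat.card ((A.fibre (𝟙 (Spec (.of Ω)))).toAbelianVariety.KTheta Θ)))
    [IsDominant (AbelianVariety.Hom.toSchemeHom ((n : ℤ) • 𝟙 (A.fibre (𝟙 (Spec (.of Ω)))).toAbelianVariety))]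
    (c : O ≃+* O) {𝔟 J' : Ideal O} (h𝔟0 : 𝔟 ≠ ⊥) (hJ'0 : J' ≠ ⊥) (h𝔟J' : 𝔟 * J' = Ideal.span {(n : O)})
    (hadj : ∀ b : O, b ≠ 0 → ∀ P Q P' Q' : (A.fibre (𝟙 (Spec (.of Ω)))).toAbelianVariety.torsionPoints Ω n,
      (P' : (A.fibre (𝟙 (Spec (.of Ω)))).toAbelianVariety.Points Ω) = φ b P →
      (Q' : (A.fibre (𝟙 (Spec (.of Ω)))).toAbelianVariety.Points Ω) = φ (c b) Q →
      (A.fibre (𝟙 (Spec (.of Ω)))).toAbelianVariety.weilPairingLevel Θ P' Q = (A.fibre (𝟙 (Spec (.of Ω)))).toAbelianVariety.weilPairingLevel Θ P Q')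
    (K K₂ : Subgroup A.Sections) (hK : ∀ σ, σ ∈ K ↔ ∀ b ∈ 𝔟, σ ≫ act.i b = 1) (hK₂ : ∀ σ, σ ∈ K₂ ↔ ∀ r ∈ J'.map (c : O →+* O), σ ≫ act.i r = 1) :
    Nat.card K * Nat.card (K₂.map (IsMonHom.monoidHom lam (𝟙_ (Over (Spec (.of Ω)))))) = n ^ (2 * g) := by
  have hN0 : n ≠ 0 := by rintro rfl; exact hn0 Nat.cast_zero
  haveI : NeZero n := ⟨hN0⟩
  haveI : NeZero (n : Ω) := ⟨hn0⟩
  -- the torsion count and finiteness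
  have hcardT : Nat.card ((A.fibre (𝟙 (Spec (.of Ω)))).toAbelianVariety.torsionPoints Ω (n : ℤ)) = n ^ (2 * g) := by
    rw [(A.fibre (𝟙 (Spec (.of Ω)))).toAbelianVariety.natCard_torsionPoints_eq_of_isAlgClosed Ω (n : ℤ) (by rw [Int.cast_natCast]; exact hn0), Int.natAbs_natCast, A.dim_fibre_of_isOfRelDim hA (𝟙 (Spec (.of Ω)))]
  haveI : Finite ((A.fibre (𝟙 (Spec (.of Ω)))).toAbelianVariety.torsionPoints Ω (n : ℤ)) := Nat.finite_of_card_ne_zero (by rw [hcardT]; exact pow_ne_zero _ hN0)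
  -- perfectness
  have hperf : ∀ Q : (A.fibre (𝟙 (Spec (.of Ω)))).toAbelianVariety.torsionPoints Ω n, (∀ P, (A.fibre (𝟙 (Spec (.of Ω)))).toAbelianVariety.weilPairingLevel Θ P Q = 1) → Q = 1 :=
    (A.fibre (𝟙 (Spec (.of Ω)))).toAbelianVariety.weilPairingLevel_eq_one_of_forall_left_of_coprime hn0 Θ hcop
  -- the restriction isomorphism `ρ : A(S) ≃ X(Ω)`
  let ρ : A.Sections →* (A.fibre (𝟙 (Spec (.of Ω)))).toAbelianVariety.Points Ω := MonoidHom.mk' (A.restrictPt (𝟙 (Spec (.of Ω)))) (A.restrictPt_mul (𝟙 (Spec (.of Ω))))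
  have hρ : ∀ σ, ρ σ = A.restrictPt (𝟙 (Spec (.of Ω))) σ := fun σ => rfl
  have hρinj : Function.Injective ρ := A.restrictPt_id_injective'
  have hρsurj : Function.Surjective ρ := A.restrictPt_id_surjective
  have hρact : ∀ r σ, φ r (ρ σ) = ρ (σ ≫ act.i r) := fun r σ => by rw [hρ, hρ, fibreAction_restrictPt act (𝟙 (Spec (.of Ω))) φ hφ]
  -- `n ∈ 𝔟` and `n ∈ c(J′)`, so both subgroups are `n`-torsion and their images lie in `X[n]`
  have hn𝔟 : (n : O) ∈ 𝔟 := Ideal.mul_le_right (h𝔟J'.symm ▸ Ideal.mem_span_singleton_self (n : O))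
  have hnJ : (n : O) ∈ J'.map (c : O →+* O) := by
    have h1 : (n : O) ∈ J' := Ideal.mul_le_left (h𝔟J'.symm ▸ Ideal.mem_span_singleton_self (n : O))
    simpa only [map_natCast] using Ideal.mem_map_of_mem (c : O →+* O) h1
  have htorsK : ∀ σ ∈ K, ρ σ ∈ (A.fibre (𝟙 (Spec (.of Ω)))).toAbelianVariety.torsionPoints Ω (n : ℤ) := fun σ hσ => by
    rw [AbelianVariety.mem_torsionPoints_iff, zpow_natCast, ← fibreAction_natCast act (𝟙 (Spec (.of Ω))) φ hφ n, hρact, (hK σ).mp hσ _ hn𝔟, hρ, restrictPt_one]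
    rfl
  have htorsK₂ : ∀ σ ∈ K₂, ρ σ ∈ (A.fibre (𝟙 (Spec (.of Ω)))).toAbelianVariety.torsionPoints Ω (n : ℤ) := fun σ hσ => by
    rw [AbelianVariety.mem_torsionPoints_iff, zpow_natCast, ← fibreAction_natCast act (𝟙 (Spec (.of Ω))) φ hφ n, hρact, (hK₂ σ).mp hσ _ hnJ, hρ, restrictPt_one]
    rfl
  have hK₂n : ∀ σ : K₂, (σ : A.Sections) ^ n = 1 := fun σ => by
    apply hρinj
    rw [map_pow, map_one, ← zpow_natCast]
    exact (AbelianVariety.mem_torsionPoints_iff _ _).mp (htorsK₂ σ.1 σ.2)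
  -- the two subgroups of `X[n]`
  let K𝔟 : Subgroup ((A.fibre (𝟙 (Spec (.of Ω)))).toAbelianVariety.torsionPoints Ω (n : ℤ)) := (K.map ρ).subgroupOf ((A.fibre (𝟙 (Spec (.of Ω)))).toAbelianVariety.torsionPoints Ω (n : ℤ))
  let K𝔠 : Subgroup ((A.fibre (𝟙 (Spec (.of Ω)))).toAbelianVariety.torsionPoints Ω (n : ℤ)) := (K₂.map ρ).subgroupOf ((A.fibre (𝟙 (Spec (.of Ω)))).toAbelianVariety.torsionPoints Ω (n : ℤ))
  have hleK : K.map ρ ≤ (A.fibre (𝟙 (Spec (.of Ω)))).toAbelianVariety.torsionPoints Ω (n : ℤ) := by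
    rintro _ ⟨σ, hσ, rfl⟩; exact htorsK σ hσ
  have hleK₂ : K₂.map ρ ≤ (A.fibre (𝟙 (Spec (.of Ω)))).toAbelianVariety.torsionPoints Ω (n : ℤ) := by
    rintro _ ⟨σ, hσ, rfl⟩; exact htorsK₂ σ hσ
  have hmemK𝔟 : ∀ x : (A.fibre (𝟙 (Spec (.of Ω)))).toAbelianVariety.torsionPoints Ω (n : ℤ), x ∈ K𝔟 ↔ ∀ b ∈ 𝔟, φ b x = 1 := by
    intro x
    rw [Subgroup.mem_subgroupOf]
    constructor
    · rintro ⟨σ, hσ, hσx⟩ b hb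
      rw [← hσx, hρact, (hK σ).mp hσ b hb, hρ]
      exact A.restrictPt_one (𝟙 (Spec (.of Ω)))
    · intro hx
      obtain ⟨σ, hσ⟩ := hρsurj (x : (A.fibre (𝟙 (Spec (.of Ω)))).toAbelianVariety.Points Ω)
      refine ⟨σ, (hK σ).mpr fun b hb => hρinj ?_, hσ⟩
      rw [← hρact, hσ, hx b hb, hρ, restrictPt_one]
      rfl
  have hmemK𝔠 : ∀ y : (A.fibre (𝟙 (Spec (.of Ω)))).toAbelianVariety.torsionPoints Ω (n : ℤ), y ∈ K𝔠 ↔ ∀ r ∈ J'.map (c : O →+* O), φ r y = 1 := by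
    intro y
    rw [Subgroup.mem_subgroupOf]
    constructor
    · rintro ⟨σ, hσ, hσy⟩ r hr
      rw [← hσy, hρact, (hK₂ σ).mp hσ r hr, hρ]
      exact A.restrictPt_one (𝟙 (Spec (.of Ω)))
    · intro hy
      obtain ⟨σ, hσ⟩ := hρsurj (y : (A.fibre (𝟙 (Spec (.of Ω)))).toAbelianVariety.Points Ω)
      refine ⟨σ, (hK₂ σ).mpr fun r hr => hρinj ?_, hσ⟩
      rw [← hρact, hσ, hy r hr, hρ, restrictPt_one]
      rfl
  -- the count on points
  have hcount := AbelianVariety.natCard_mul_natCard_eq_of_idealTorsion (φ := φ) (hmul := fibreAction_mul act (𝟙 (Spec (.of Ω))) φ hφ)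
    (hadd := fibreAction_add act (𝟙 (Spec (.of Ω))) φ hφ) (hcomp := fibreAction_mul_eq_comp act (𝟙 (Spec (.of Ω))) φ hφ) (hone := fibreAction_one act (𝟙 (Spec (.of Ω))) φ hφ)
    (hsurj := hsurj) (hN := fibreAction_natCast act (𝟙 (Spec (.of Ω))) φ hφ n) c h𝔟0 hJ'0 h𝔟J' hnO Θ hadj hperf K𝔟 K𝔠 hmemK𝔟 hmemK𝔠
  -- transfer the cardinalities
  have hcK : Nat.card K𝔟 = Nat.card K := by
    rw [Nat.card_congr (Subgroup.subgroupOfEquivOfLe hleK).toEquiv, Subgroup.card_map_of_injective hρinj]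
  have hcK₂ : Nat.card K𝔠 = Nat.card K₂ := by
    rw [Nat.card_congr (Subgroup.subgroupOfEquivOfLe hleK₂).toEquiv, Subgroup.card_map_of_injective hρinj]
  rw [natCard_map_monoidHom_eq_of_coprime D lam hΘ hcop K₂ hK₂n, ← hcK, ← hcK₂, hcount, hcardT]

end Count

end AbelianSchemeOver

end Literature.AlgebraicGeometry.AbelianSchemes

end
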